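/-
Copyright (c) 2026. All rights reserved.
Released under Apache 2.0 license as described in the file LICENSE.
Authors: abc-iut cell, seat abc-iut-w5-d226 (gen 2; node `AbsTopIII:Lem4.3`, CAF case — the case
consumed by `EA` / Prop 4.2 (i), sub-DAG row P42.i/L09 of plan/L4/SUBDAG-AbsTopIII-Prop42.md).
-/
import Literature.AnabelianGeometry.AbsoluteAnabelian.ArchimedeanLogFrobeniusFunctors
import Literature.AnabelianGeometry.AbsoluteAnabelian.AbsAnabFundamentalGroups
import Literature.AnabelianGeometry.AbsoluteAnabelian.SlimTransport
import Literature.NumberTheory.EllipticCurves.SelmerGaloisAction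
import HarnessLib

/-!
# [AbsTopIII] Lemma 4.3 (slimness of archimedean fundamental groups): the CAF case, proved

S. Mochizuki, *Topics in absolute anabelian geometry III*, Lemma 4.3 p. 106 of the author's kurims
manuscript (lit key `paper:url-5493eb38cbb7`, read on the page; bib key `MochizukiAbsTopIII2015`):
"Let `X` be a hyperbolic orbicurve over an archimedean field `k_X`.  Then the étale fundamental group
`Π_X` of `X` is slim."  Printed proof, first step: "we have an exact sequence of profinite groups
`1 → Δ_X → Π_X → G → 1` [where `Δ_X := π₁(X ×_{k_X} k̄_X)`; `G := Gal(k̄_X/k_X)`].  Since `Δ_X` is slim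
[cf., e.g., [Mzk20], Proposition 2.3, (i)], it suffices to consider the case where there exists an
element `σ ∈ Π_X` that maps to a nontrivial element `σ_G ∈ G ≅ ℤ/2ℤ` …" — i.e. for a CAF `k_X`
(`G = 1`) the lemma IS the slimness of `Δ_X`; the remaining (RAF) case is the `H²(Δ_X, ℚ_l(1))` /
first-Chern-class argument of p. 106 l. 40 – p. 107 l. 3.

PROOF-ONLY companion (no new notion) to abc-iut-L4-t14's named fact
`Literature.AnabelianGeometry.AbsoluteAnabelian.Lem_4_3 (M : AbsTopIII.CurveModel)`
(`ArchimedeanLogFrobeniusFunctors.lean`), in the cell's (M)-shape over abc-iut-L4-t1's `CurveModel`: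

* (reused BY NAME from `Literature.NumberTheory.EllipticCurves.SelmerGaloisAction`:
  `isAlgClosed_of_ringEquiv` — a field isomorphic to `ℂ` is algebraically closed — and
  `subsingleton_absoluteGaloisGroup_of_isAlgClosed` — `Gal(k̄/k)` is trivial for `k` algebraically closed);
* `isSlimGroup_of_subsingleton`: a trivial topological group is slim;
  `AbsTopIII.CurveModel.isSlimGroup_gal_of_CAF`: over a CAF base the Galois group `G` of the model's
  extension is slim (it is trivial, via `galIso : G ≅ Gal(k̄/k)`);
* **`AbsTopIII.CurveModel.lem_4_3_CAF`**: for every curve `U` of the model whose base field is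
  field-isomorphic to `ℂ`, `Δ_U` slim ⇒ `Π_U` slim — Lemma 4.3 in the CAF case, the printed deduction,
  with its one printed input "[Mzk20] Prop 2.3 (i): `Δ_X` is slim" as the hypothesis (the geometric
  slimness is [AbsTopI] Prop 2.3 (i) / pro-surface-group slimness, FACT-policy at the model:
  `CurveModel` does not record that `Δ_U` is a surface group); assembled by abc-iut-L4-t4's
  `FundamentalExtension.arith_slim_of_geom_slim_of_gal_slim`;
* `AbsTopIII.CurveModel.lem_4_3_of_CAF_bases`: hence `Lem_4_3 M` itself for any model all of whose
  archimedean base fields are CAFs, modulo geometric slimness.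

Scope: the RAF case (`k_X ≅ ℝ`, `G ≅ ℤ/2ℤ`, which is NOT slim, so the formal extension lemma does not
apply) needs the `G`-module `H²(Δ_X, ℚ_l(1))` (first Chern class of the canonical bundle), which the
`CurveModel` interface does not carry — not treated here.  This is the case NOT used by §4's `EA`
(elliptically admissible orbicurves over CAFs, Def 4.1 (i)/(iii)).  Refereed pre-IUT anabelian
geometry; nothing here bears on [IUTchIII] Cor. 3.12 or takes a side.
-/

set_option autoImplicit false

universe u

namespace Literature.AnabelianGeometry.AbsoluteAnabelian

open Literature.AlgebraicGeometry.Frobenioids (IsSlimGroup)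

/-! ### A trivial topological group is slim -/

/-- A topological group with at most one element is slim (every centraliser is `⊥ = ⊤`).
[cite: MochizukiAbsTopIII2015, Lemma 4.3 p.106] -/
theorem isSlimGroup_of_subsingleton {G : Type u} [Group G] [TopologicalSpace G] [Subsingleton G] :
    IsSlimGroup G :=
  ⟨fun _ _ => Subsingleton.elim _ _⟩

namespace AbsTopIII.CurveModel

variable (M : AbsTopIII.CurveModel.{u})

/-- Over a base field that is field-isomorphic to `ℂ` (a CAF: "the étale fundamental group does not
see the topology of `k`"), the Galois group `G = Gal(k̄/k)` of the model's extension
`1 → Δ_U → Π_U → G → 1` is trivial. [cite: MochizukiAbsTopIII2015, Lemma 4.3 p.106] -/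
theorem subsingleton_gal_of_CAF (U : M.Curve) (hk : Nonempty (M.base U ≃+* ℂ)) :
    Subsingleton (M.ext U).gal := by
  obtain ⟨e⟩ := hk
  haveI : IsAlgClosed (M.base U) :=
    Literature.NumberTheory.EllipticCurves.isAlgClosed_of_ringEquiv e.symm
  haveI : Subsingleton (absoluteGaloisGrp (M.base U)) :=
    Literature.NumberTheory.EllipticCurves.subsingleton_absoluteGaloisGroup_of_isAlgClosed (M.base U)
  obtain ⟨i⟩ := nonempty_continuousMulEquiv_of_iso (M.galIso U)
  exact i.injective.subsingleton

/-- Over a CAF base the Galois group `G` of the model's extension is slim (it is trivial).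
[cite: MochizukiAbsTopIII2015, Lemma 4.3 p.106] -/
theorem isSlimGroup_gal_of_CAF (U : M.Curve) (hk : Nonempty (M.base U ≃+* ℂ)) :
    IsSlimGroup (M.ext U).gal := by
  haveI := M.subsingleton_gal_of_CAF U hk
  exact isSlimGroup_of_subsingleton

/-- Over a CAF base, `Δ_U = Π_U` (the augmentation is trivial).
[cite: MochizukiAbsTopIII2015, Lemma 4.3 p.106] -/
theorem geom_eq_top_of_CAF (U : M.Curve) (hk : Nonempty (M.base U ≃+* ℂ)) :
    (M.ext U).geom = ⊤ := by
  haveI := M.subsingleton_gal_of_CAF U hk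
  rw [eq_top_iff]
  intro x _
  rw [FundamentalExtension.mem_geom]
  exact Subsingleton.elim _ _

/-- **[AbsTopIII] Lemma 4.3, CAF case**: for a hyperbolic orbicurve `U` of the model over a base field
field-isomorphic to `ℂ`, "since `Δ_X` is slim [cf., e.g., [Mzk20], Proposition 2.3, (i)]" — taken as
the hypothesis `hΔ` — the étale fundamental group `Π_U` is slim (here `G = 1`, so nothing else is
needed; the extension lemma is abc-iut-L4-t4's `arith_slim_of_geom_slim_of_gal_slim`).
[cite: MochizukiAbsTopIII2015, Lemma 4.3 p.106] -/
theorem lem_4_3_CAF (U : M.Curve) (hk : Nonempty (M.base U ≃+* ℂ))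
    (hΔ : IsSlimGroup (M.ext U).geom) : IsSlimGroup (M.ext U).arith :=
  (M.ext U).arith_slim_of_geom_slim_of_gal_slim hΔ (M.isSlimGroup_gal_of_CAF U hk)

/-- The CAF case also gives both halves of [AbsAnab] Lemma 1.3.1's predicate `GeomAndArithSlim`
for such `U`. [cite: MochizukiAbsTopIII2015, Lemma 4.3 p.106] -/
theorem geomAndArithSlim_of_CAF (U : M.Curve) (hk : Nonempty (M.base U ≃+* ℂ))
    (hΔ : IsSlimGroup (M.ext U).geom) : (M.ext U).GeomAndArithSlim :=
  ⟨hΔ, M.lem_4_3_CAF U hk hΔ⟩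

/-- **`Lem_4_3 M` for models whose archimedean base fields are all CAFs** (no curve of the model has a
base field field-isomorphic to `ℝ` — e.g. the situation of Def 4.1 / Prop 4.2, where `EA` consists of
orbicurves over CAFs), modulo the geometric slimness "[Mzk20] Prop 2.3 (i)" at the CAF curves.
[cite: MochizukiAbsTopIII2015, Lemma 4.3 p.106] -/
theorem lem_4_3_of_CAF_bases
    (hRAF : ∀ U : M.Curve, Nonempty (M.base U ≃+* ℝ) → Nonempty (M.base U ≃+* ℂ))
    (hΔ : ∀ U : M.Curve, Nonempty (M.base U ≃+* ℂ) → IsSlimGroup (M.ext U).geom) :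
    Lem_4_3 M := by
  intro U hU
  have hk : Nonempty (M.base U ≃+* ℂ) := hU.elim id (hRAF U)
  exact M.lem_4_3_CAF U hk (hΔ U hk)

/-- Conversely, `Lem_4_3 M` contains the CAF case: for a curve over a CAF base it yields `Π_U` slim,
and then `Δ_U = Π_U` (`geom_eq_top_of_CAF`) is slim as well — so at CAF curves Lemma 4.3 is
EQUIVALENT to the geometric slimness it cites. [cite: MochizukiAbsTopIII2015, Lemma 4.3 p.106] -/
theorem geom_slim_of_lem_4_3_of_CAF (h : Lem_4_3 M) (U : M.Curve) (hk : Nonempty (M.base U ≃+* ℂ)) :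
    IsSlimGroup (M.ext U).geom := by
  have hPi : IsSlimGroup (M.ext U).arith := h U (Or.inl hk)
  have htop := M.geom_eq_top_of_CAF U hk
  -- transport along `Δ_U = ⊤ ≃ₜ* Π_U`
  let e : (M.ext U).geom ≃ₜ* (M.ext U).arith :=
    { toMulEquiv := (MulEquiv.subgroupCongr htop).trans Subgroup.topEquiv
      continuous_toFun := continuous_subtype_val
      continuous_invFun := by
        apply Continuous.subtype_mk
        exact continuous_id }
  exact isSlimGroup_of_continuousMulEquiv e.symm hPi

end AbsTopIII.CurveModel

end Literature.AnabelianGeometry.AbsoluteAnabelian
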